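import Summits.BirchSwinnertonDyer.BirchSwinnertonDyer.Theorems.PrintCFramBottomClassIndexLawFiveLeEisensteinSockets
import Literature.RingTheory.PowerSeries.ResidualOrderAssociated
import HarnessLib

/-!
# Route `PrintCFram`, crux C2 `BottomClassIndexLawFiveLe` (stmt-BirchSwinnertonDyer-20372), line `eisenstein-resource-bdp-line`:
# the registered upgrade stub `stub_invariantUpgrade_cmRamified` REDUCED BY NAME to Greenberg–Vatsal INVARIANT DATA
# (principal generator of the mapped characteristic ideal, a common `μ`-part, equal residual order = equal `λ`)
# through the proved hinge `Literature.RingTheory.PowerSeries.span_singleton_le_of_le_of_eq_mul_of_order_map_residue_eq`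
# (cell `bsd-print-cfram`, seat `bsd-line-cfram-p1` LEAD g3; helper `--supports` 20372; THEOREMS ONLY, 0 facts)

HONEST FRAMING. Nothing about BSD is proved; the stub is NOT closed. Critic idea-crit-10 V#17 split the upgrade stub into
S2a–S2d with «S2d hinge generalisation = first prover target»; S2d is now the Literature theorem (p617222, general local ring,
`μ`-twisted domain form) and THIS file plugs it into the stub: `stub_invariantUpgrade_cmRamified_of_invariants` proves the
REGISTERED signature of stub 2 verbatim from ONE displayed hypothesis `hinv` = «at every CM-ramified row / Heegner field /
anticyclotomic frame / ♭-BDP frame `Q` where the Eisenstein inclusion `Ch·𝓞_{ℂ_p}⟦T⟧ ⊆ (Q)` holds, the mapped characteristic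
ideal is principal, `(C)`, and `C`, `Q` have a common `μ`-part `c ≠ 0` with cofactors `C₀`, `Q₀` of non-zero reduction of the
SAME residual order» (S2a ∧ S2b ∧ S2c: the Greenberg–Vatsal comparison `Sel_(∅,0)(f_W/K''_∞) ~ Sel(χ) ⊕ Sel(χω_K)` and the
Kriz–Li / Katz-side congruence, both UNPRINTED at an additive prime — the research that remains of stub 2). So after this file
stub 2 = `hinv` exactly; nothing else. BSD is not proved by any of this.

References: Castella–Grossi–Lee–Skinner, Invent. Math. 227 (2022) Thm. 3.2.1 and proof of Thm. 5.1.1 (arXiv:2008.02571 p. 23)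
[CastellaGrossiLeeSkinner2022]; Greenberg–Vatsal, Invent. Math. 142 (2000) §1 [GreenbergVatsal2000]; Kriz–Li, Forum Math.
Sigma 7 (2019) Thm. 1.12 [KrizLi2019].
-/

noncomputable section

open scoped Classical

set_option linter.dupNamespace false
set_option autoImplicit false

namespace Summit.BirchSwinnertonDyer.BirchSwinnertonDyer.Theorems.PrintCFram.EisensteinResourceBdpLine

open WeierstrassCurve NumberField IsDedekindDomain Field PowerSeries
  Literature.NumberTheory.EllipticCurves
  Literature.NumberTheory.EllipticCurves.ModularForms
  Literature.NumberTheory.EllipticCurves.Rank1Residual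
  Literature.NumberTheory.EllipticCurves.Rank1Residual.Typed
  Literature.NumberTheory.EllipticCurves.KrizLi2019
  Literature.NumberTheory.GaloisRepresentations
  Literature.NumberTheory.GaloisCohomology
  Summit.BirchSwinnertonDyer.Rank1Residual
  Summit.BirchSwinnertonDyer.Rank1Residual.Additive
  Summit.BirchSwinnertonDyer.Rank1Residual.X11b
  Summit.BirchSwinnertonDyer.Rank1Residual.X11b.AcSelmer
  Summit.BirchSwinnertonDyer.Rank1Residual.X11b.Halves
  Summit.BirchSwinnertonDyer.Rank1Residual.X11b.CongruenceLimit
  Summit.BirchSwinnertonDyer.Rank1Residual.X12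
  Summit.BirchSwinnertonDyer.BirchSwinnertonDyer.Theses.UniversalToricDescent
  Summit.BirchSwinnertonDyer.BirchSwinnertonDyer.Theorems
  Summit.BirchSwinnertonDyer.BirchSwinnertonDyer.Theorems.SchneiderFree
  Summit.BirchSwinnertonDyer.BirchSwinnertonDyer.Theorems.SchneiderFreeControlAtoms
  Summit.BirchSwinnertonDyer.BirchSwinnertonDyer.Theorems.SchneiderFreeAdditiveX3
  Summit.BirchSwinnertonDyer.BirchSwinnertonDyer.Theorems.UniversalToricDescentWaldspurgerFlat
  Summit.BirchSwinnertonDyer.BirchSwinnertonDyer.Theorems.AdditivePotSupersingularControl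
  Summit.BirchSwinnertonDyer.BirchSwinnertonDyer.Theorems.RamifiedSevenEllipticUnits

/-- **Stub 2 of the skeleton of record ⟸ invariant data (S2a ∧ S2b ∧ S2c), by the proved hinge S2d.** The conclusion is the
REGISTERED signature of `stub_invariantUpgrade_cmRamified` verbatim; the hypothesis `hinv` asks, at every frame where the
Eisenstein inclusion holds, for a principal generator `C` of the mapped characteristic ideal and a common `μ`-part `c ≠ 0` with
cofactors of non-zero reduction and equal residual order; the hinge
`Literature.RingTheory.PowerSeries.span_singleton_le_of_le_of_eq_mul_of_order_map_residue_eq` (over the local domain `𝓞_{ℂ_p}`)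
gives the reverse inclusion. CONDITIONAL on `hinv` (research: Greenberg–Vatsal comparison at an additive split prime + the
analytic congruence); closes nothing. [cite: CastellaGrossiLeeSkinner2022, Thm. 3.2.1 and proof of Thm. 5.1.1 (arXiv:2008.02571 pp. 4, 23)]
[cite: GreenbergVatsal2000, §1 p. 18, (1)–(2)] -/
theorem stub_invariantUpgrade_cmRamified_of_invariants
    (hinv : ∀ (p : ℕ) [Fact p.Prime] (W : WeierstrassCurve ℚ) [W.IsElliptic] [W.IsGloballyMinimal],
      W.HasCM → CMRamified W p → 5 ≤ p → W.analyticRank = 1 →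
      ∀ (N : ℕ) [NeZero N] (K : Type) [Field K] [NumberField K] (Dt : ModularParametrizationData W N),
      W.conductorNorm ℤ = N → IsImaginaryQuadratic K → SatisfiesHeegnerHypothesis N K →
      ∀ (κ : ZpExtension K p), κ.IsAnticyclotomic → ∀ (γ : Field.absoluteGaloisGroup K) [Fact (κ.IsTopGenerator γ)]
        (𝔭 : HeightOneSpectrum (𝓞 K)), ((p : ℕ) : 𝓞 K) ∈ 𝔭.asIdeal → 𝔭.asIdeal.ramificationIdx (𝓞 ℚ) = 1 →
        𝔭.asIdeal.inertiaDeg (𝓞 ℚ) = 1 → ∀ (𝔭' : HeightOneSpectrum (𝓞 K)), ((p : ℕ) : 𝓞 K) ∈ 𝔭'.asIdeal → 𝔭' ≠ 𝔭 →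
        ∀ (ι' : PadicAlgCl p ≃+* ℂ), SchneiderFree.BranchInducesPrime p ι' 𝔭 →
        ∀ (ΩK : ℂ) (Ωp : ℂ_[p]) (Q : PowerSeries (PadicComplexInt p)), ΩK ≠ 0 → Ωp ≠ 0 →
          R1.IsBDPLFunctionInt p ι' 𝔭 κ γ Dt.f ΩK Ωp Q →
          (XAc.charIdeal (W.baseChange K) p κ 𝔭' ∅ γ).map (PowerSeries.map (R1.toCpInt p)) ≤ Ideal.span {Q} →
          ∃ (C c C₀ Q₀ : PowerSeries (PadicComplexInt p)),
            (XAc.charIdeal (W.baseChange K) p κ 𝔭' ∅ γ).map (PowerSeries.map (R1.toCpInt p)) = Ideal.span {C} ∧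
            c ≠ 0 ∧ C = c * C₀ ∧ Q = c * Q₀ ∧
            PowerSeries.map (IsLocalRing.residue (PadicComplexInt p)) C₀ ≠ 0 ∧
            (PowerSeries.map (IsLocalRing.residue (PadicComplexInt p)) Q₀).order =
              (PowerSeries.map (IsLocalRing.residue (PadicComplexInt p)) C₀).order) :
    ∀ (p : ℕ) [Fact p.Prime] (W : WeierstrassCurve ℚ) [W.IsElliptic] [W.IsGloballyMinimal],
      W.HasCM → CMRamified W p → 5 ≤ p → W.analyticRank = 1 →
      ∀ (N : ℕ) [NeZero N] (K : Type) [Field K] [NumberField K] (Dt : ModularParametrizationData W N),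
      W.conductorNorm ℤ = N → IsImaginaryQuadratic K → SatisfiesHeegnerHypothesis N K →
      ∀ (κ : ZpExtension K p), κ.IsAnticyclotomic → ∀ (γ : Field.absoluteGaloisGroup K) [Fact (κ.IsTopGenerator γ)]
        (𝔭 : HeightOneSpectrum (𝓞 K)), ((p : ℕ) : 𝓞 K) ∈ 𝔭.asIdeal → 𝔭.asIdeal.ramificationIdx (𝓞 ℚ) = 1 →
        𝔭.asIdeal.inertiaDeg (𝓞 ℚ) = 1 → ∀ (𝔭' : HeightOneSpectrum (𝓞 K)), ((p : ℕ) : 𝓞 K) ∈ 𝔭'.asIdeal → 𝔭' ≠ 𝔭 →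
        ∀ (ι' : PadicAlgCl p ≃+* ℂ), SchneiderFree.BranchInducesPrime p ι' 𝔭 →
        ∀ (ΩK : ℂ) (Ωp : ℂ_[p]) (Q : PowerSeries (PadicComplexInt p)), ΩK ≠ 0 → Ωp ≠ 0 →
          R1.IsBDPLFunctionInt p ι' 𝔭 κ γ Dt.f ΩK Ωp Q →
          (XAc.charIdeal (W.baseChange K) p κ 𝔭' ∅ γ).map (PowerSeries.map (R1.toCpInt p)) ≤ Ideal.span {Q} →
          Ideal.span {Q} ≤ (XAc.charIdeal (W.baseChange K) p κ 𝔭' ∅ γ).map (PowerSeries.map (R1.toCpInt p)) := by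
  intro p _ W _ _ hCM hram h5 hr N _ K _ _ Dt hN hK hHN κ hκ γ _ 𝔭 h𝔭 he hf 𝔭' h𝔭' hne ι' hind ΩK Ωp Q hΩK hΩp hBDP hle
  obtain ⟨C, c, C₀, Q₀, hI, hc, hC, hQ, hC₀, hord⟩ :=
    hinv p W hCM hram h5 hr N K Dt hN hK hHN κ hκ γ 𝔭 h𝔭 he hf 𝔭' h𝔭' hne ι' hind ΩK Ωp Q hΩK hΩp hBDP hle
  exact Literature.RingTheory.PowerSeries.span_singleton_le_of_le_of_eq_mul_of_order_map_residue_eq hI hle hc hC hQ hC₀ hord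

end Summit.BirchSwinnertonDyer.BirchSwinnertonDyer.Theorems.PrintCFram.EisensteinResourceBdpLine

end
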